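import Summits.QuantumFields.YangMills.Theorems.FluctuationComparisonRegPrIntLS2BetaFlatTubeTowerStep
import HarnessLib

/-!
# GAP♭ AT THE FLAT DATUM AT EVERY DEPTH WITH A VOLUME-UNIFORM CONSTANT, II — `μ(L, K − J)` chosen before the family, the coupling and the run
# (crux `FluctuationComparisonRegPrIntL`, stmt-QuantumFields-20520; registry v11.4 `Cruxes/FluctuationComparisonRegPrIntL/Lines/semiclassical_s2beta.lean` 3732b7df FROZEN, untouched)

Cell `ym3-torus` (YM ladder rung R3 = continuum `SU(2)` Yang–Mills on the three-torus — a RUNG: NOT d = 4, NOT infinite volume, NOT a mass gap, NOT Clay).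
Width seat `ym3-torus-px12` (gen 22); `--kind proof --supports stmt-QuantumFields-20520 --as helper`, count-neutral, DEFINITION-FREE (0 `def`, 0 `instance`,
0 `notation`, 0 `sorry`, default heartbeats).

WHY.  ✓`…S2BetaFlatTubeTowerStep.flat_tower` gives, for a FIXED threshold under the two guards, a residual transformation with `Σ dist1² ≤ β(L)(α(L)+1)^m·A(U)` for every
flat-fibre field of depth `m` whose descended fields have small plaquettes.  This file reads it under the registry's prefix: the threshold is `θ*(L)` (both guards), the
coupling bound `γ₁` comes from lit ✓`T3Thresholds.exists_gamma_forall_θBal_le` at `σ := θ*(L)` (so every `θBal` of the history is `≤ θ*`, and a good history has all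
descended plaquettes `< θ*` — ✓`plaqSmall_fieldShift`), and `μ(L, m) := L^{2m}∕(β(α+1)^m + 1)`; the excess action over the flat datum is `A(U)` itself
(✓`minActionRegPr_one`).  Depth one is ✓`…S2BetaFlatTubeDepthOneUniform.tubeGrowth_flat_depthOne_uniform`.

WHAT.
* ★★★ `gapFlat_flat_allDepths_volumeUniform` — `∀ L b₀ p₀, ∃ γ₁ > 0, ∀ m, ∃ μ > 0, ∀ F (F.L = L), ∀ 0 < γ ≤ γ₁, ∀ J ≤ K with K − J = m, ∀ ε₀ > 0,
  ∀ U ∈ fibre_{J,K}(1) ∩ histGood(θBal b₀): μ·L^{−2(K−J)}·⨅_{w residual} Σ_ℓ dist1(U ℓ·((w • 1) ℓ)⁻¹)² ≤ wilsonAction4 U − minActionRegPr … ε₀ 1` — GAP♯∘'s body at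
  `(V, U₀) = (1, 1)` with `μ` depending on `L` and the DEPTH only, never on the run ∕ volume.

HONEST: the flat datum only; `μ(L, m)` decays geometrically in the depth `m` — the DEPTH-uniformity of TUBE-REG∘∕GAP♯∘ ([Balaban1984PropagatorsII] (1.33), multi-scale) is NOT
touched; constants crude; lattice kinematics + Cauchy–Schwarz; nothing of Bałaban's analysis; TUBE-REG∘, GAP♯∘, EXW∘, S2β, crux 20520 NOT proved; no registered stub is closed;
rung R3 = SU(2) YM₃ on T³ — NOT d = 4, NOT infinite volume, NOT a mass gap, NOT Clay; the Yang–Mills mass gap is NOT proved.  Sorry-free, axioms standard.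

References: T. Bałaban, CMP **99** (1985) 75–102 [Balaban1985RegularSpaces] (Lemma 1 (1.24)–(1.26) pp.79–80); CMP **102** (1985) 277–309 [Balaban1985Variational]
((142) p.299, Thm 1 (8)–(10) p.279); CMP **96** (1984) 223–250 [Balaban1984PropagatorsII] ((1.33)); CMP **102** (1985) 255–275 [Balaban1985UV3] ((7) p.257, (12)–(13) p.259).
-/

set_option autoImplicit false

noncomputable section

namespace Summit.QuantumFields.YangMills.Theorems.FluctuationComparisonRegPrIntLS2BetaFlatTubeAllDepthsVolumeUniform

open Finset
open Literature.MathematicalPhysics.QuantumFieldTheory.Balaban1983to89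
open T4Continuum BlockAveraging AveragingRT ExpMeanLog
open T3ContinuumYM3Torus
open T3UnitLawDensityEML (ℰp)
open T3UnitScaleTilt T3TiltDescent T3LevelShift
open T3ConstrainedMinimiser (fibre)
open T3PrintedRegularMinimiser
open T3PrintedMinimiserExistence (plaqSmall_of_le)
open T3CruxEstimates (plaqSmall_fieldShift)
open T3Thresholds (exists_gamma_forall_θBal_le)
open Summit.QuantumFields.YangMills.Theorems.FluctuationComparisonRegPrIntLS2BetaFlatTubeTowerStep (flat_tower)

open scoped Matrix.Norms.L2Operator

section Final

variable {P : Params}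

/-! ## §3 GAP♭ at the flat datum at every depth, `μ(L, K − J)` before the run -/

/-- ★★★ **GAP♭ AT THE FLAT DATUM, EVERY DEPTH, VOLUME-UNIFORM**: for every `L`, `b₀ > 0`, `p₀ > 0` there is `γ₁ > 0`, and for every depth `m` a constant `μ > 0` — chosen
BEFORE the family, the coupling and the run — such that for every family with `F.L = L`, every `0 < γ ≤ γ₁`, every `J ≤ K` with `K − J = m`, every `ε₀ > 0` and every good
history `U` of the flat fibre `fibre_{J,K}(1)`: `μ·L^{−2(K−J)}·⨅_{w residual} Σ_ℓ dist1(U ℓ·((w • 1) ℓ)⁻¹)² ≤ wilsonAction4 U − minActionRegPr … ε₀ 1` (GAP♯∘'s body at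
`(V, U₀) = (1, 1)`; the orbit functional and the residual set spelled as in ✓`…S2BetaFlatGapOutright.exists_gapFlat_flat`). `μ` decays geometrically in `m`.
[cite: Balaban1985Variational, (142) p.299, Thm 1 (8)-(10) p.279; Balaban1984PropagatorsII, (1.33); Balaban1985RegularSpaces, Lemma 1 (1.24)-(1.26) pp.79-80] -/
theorem gapFlat_flat_allDepths_volumeUniform (L : ℕ) (b₀ p₀ : ℝ) (hb : 0 < b₀) (hp : 0 < p₀) :
    ∃ γ₁ : ℝ, 0 < γ₁ ∧ ∀ m : ℕ, ∃ μ : ℝ, 0 < μ ∧ ∀ (F : T3Family) (γ : ℝ), F.L = L → 0 < γ → γ ≤ γ₁ →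
      ∀ (J K : ℕ) (hJK : J ≤ K), K - J = m → ∀ (ε₀ : ℝ), 0 < ε₀ →
        ∀ U ∈ fibre F ℰp J K hJK (1 : GaugeField (F.P J) 0 (Matrix.specialUnitaryGroup (Fin 2) ℂ)), U ∈ histGood F ℰp (θBal F.L γ b₀ p₀) K J →
          μ * ((F.L : ℝ)⁻¹) ^ (2 * (K - J)) *
          (⨅ w : {w : Site (F.P K) 0 → Matrix.specialUnitaryGroup (Fin 2) ℂ |
          ∀ U : GaugeField (F.P K) 0 (Matrix.specialUnitaryGroup (Fin 2) ℂ),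
          descendTo F ℰp J K hJK (GaugeField.gaugeAct w U) = descendTo F ℰp J K hJK U},
          ∑ ℓ : PBond (F.P K) 0,
          dist1 (U ℓ * ((GaugeField.gaugeAct (w : Site (F.P K) 0 → Matrix.specialUnitaryGroup (Fin 2) ℂ) (1 : GaugeField (F.P K) 0 (Matrix.specialUnitaryGroup (Fin 2) ℂ))) ℓ)⁻¹) ^ 2)
          ≤ wilsonAction4 U - minActionRegPr F J K hJK ε₀ (1 : GaugeField (F.P J) 0 (Matrix.specialUnitaryGroup (Fin 2) ℂ)) := by
  classical
  rcases Nat.eq_zero_or_pos L with hL0 | hLpos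
  · subst hL0
    exact ⟨1, one_pos, fun m => ⟨1, one_pos, fun F γ hFL => absurd hFL (by have := F.hL.2; omega)⟩⟩
  have hLr : (0 : ℝ) < L := by exact_mod_cast hLpos
  -- the guard threshold `θ*`
  have ht0 : (0 : ℝ) < (deltaSU (Fin 2) / ((((3 + 2) * L : ℕ) : ℝ) ^ 2 / 4)) := by
    have hδ := ExpMeanLog.deltaSU_pos (n := Fin 2)
    have : (0 : ℝ) < ((((3 + 2) * L : ℕ) : ℝ)) := by exact_mod_cast Nat.mul_pos (by norm_num) hLpos
    positivity
  set θs : ℝ := (deltaSU (Fin 2) / ((((3 + 2) * L : ℕ) : ℝ) ^ 2 / 4)) / (Real.sqrt ((3 ^ 2 * (2 * (2 * 3 * L + L) + 1) ^ 3 : ℕ) : ℝ) + Real.sqrt ((3 ^ 2 * (2 * (3 * L) + 1) ^ 3 * (2 * 3 + 1) ^ 3 : ℕ) : ℝ) + 1) with hθs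
  have hden : (0 : ℝ) < Real.sqrt ((3 ^ 2 * (2 * (2 * 3 * L + L) + 1) ^ 3 : ℕ) : ℝ) + Real.sqrt ((3 ^ 2 * (2 * (3 * L) + 1) ^ 3 * (2 * 3 + 1) ^ 3 : ℕ) : ℝ) + 1 := by positivity
  have hθs0 : 0 < θs := div_pos ht0 hden
  have hsq1 := Real.sqrt_nonneg ((3 ^ 2 * (2 * (2 * 3 * L + L) + 1) ^ 3 : ℕ) : ℝ)
  have hsq2 := Real.sqrt_nonneg ((3 ^ 2 * (2 * (3 * L) + 1) ^ 3 * (2 * 3 + 1) ^ 3 : ℕ) : ℝ)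
  have hg1 : Real.sqrt ((3 ^ 2 * (2 * (2 * 3 * L + L) + 1) ^ 3 : ℕ) : ℝ) * θs < (deltaSU (Fin 2) / ((((3 + 2) * L : ℕ) : ℝ) ^ 2 / 4)) := by
    rw [hθs, mul_div_assoc', div_lt_iff₀ hden]
    have hm1 := mul_nonneg ht0.le hsq2
    nlinarith
  have hg2 : Real.sqrt ((3 ^ 2 * (2 * (3 * L) + 1) ^ 3 * (2 * 3 + 1) ^ 3 : ℕ) : ℝ) * θs < (deltaSU (Fin 2) / ((((3 + 2) * L : ℕ) : ℝ) ^ 2 / 4)) := by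
    rw [hθs, mul_div_assoc', div_lt_iff₀ hden]
    have hm1 := mul_nonneg ht0.le hsq1
    nlinarith
  obtain ⟨γ₁, hγ₁, hγ₁1, hθ⟩ := exists_gamma_forall_θBal_le (b₀ := b₀) (p₀ := p₀) hb hp hθs0
  refine ⟨γ₁, hγ₁, fun m => ?_⟩
  -- the depth-`m` constant
  have hC0 : (0 : ℝ) ≤ 8 * ((2 * (((3 : ℕ) : ℝ) * (L : ℝ)) ^ 2 + 2 * (6 * ((((3 + 2) * L : ℕ) : ℝ) ^ 2 / 4)) + ((3 * ((L - 1) / 2) : ℕ) : ℝ) * (4 * (((3 : ℕ) : ℝ) * (L : ℝ)) ^ 2 + 2)) ^ 2 * ((3 * (2 * (2 * 3 * L + L + 3 * L) + 1) ^ 3 : ℕ) : ℝ)) * (2 * ((3 * (2 * (3 * L) + 1) ^ 3 : ℕ) : ℝ) * (((2 : ℕ) : ℝ) * (((L : ℝ) ^ 2 + 6 * (((3 + 2) * L : ℕ) : ℝ) ^ 2) ^ 2 * ((3 ^ 2 * (2 * 3 + 1) ^ 3 : ℕ) : ℝ))) + 1) ^ m := by positivity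
  have hCpos : (0 : ℝ) < 8 * ((2 * (((3 : ℕ) : ℝ) * (L : ℝ)) ^ 2 + 2 * (6 * ((((3 + 2) * L : ℕ) : ℝ) ^ 2 / 4)) + ((3 * ((L - 1) / 2) : ℕ) : ℝ) * (4 * (((3 : ℕ) : ℝ) * (L : ℝ)) ^ 2 + 2)) ^ 2 * ((3 * (2 * (2 * 3 * L + L + 3 * L) + 1) ^ 3 : ℕ) : ℝ)) * (2 * ((3 * (2 * (3 * L) + 1) ^ 3 : ℕ) : ℝ) * (((2 : ℕ) : ℝ) * (((L : ℝ) ^ 2 + 6 * (((3 + 2) * L : ℕ) : ℝ) ^ 2) ^ 2 * ((3 ^ 2 * (2 * 3 + 1) ^ 3 : ℕ) : ℝ))) + 1) ^ m + 1 := by linarith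
  refine ⟨((L : ℝ) ^ 2) ^ m / (8 * ((2 * (((3 : ℕ) : ℝ) * (L : ℝ)) ^ 2 + 2 * (6 * ((((3 + 2) * L : ℕ) : ℝ) ^ 2 / 4)) + ((3 * ((L - 1) / 2) : ℕ) : ℝ) * (4 * (((3 : ℕ) : ℝ) * (L : ℝ)) ^ 2 + 2)) ^ 2 * ((3 * (2 * (2 * 3 * L + L + 3 * L) + 1) ^ 3 : ℕ) : ℝ)) * (2 * ((3 * (2 * (3 * L) + 1) ^ 3 : ℕ) : ℝ) * (((2 : ℕ) : ℝ) * (((L : ℝ) ^ 2 + 6 * (((3 + 2) * L : ℕ) : ℝ) ^ 2) ^ 2 * ((3 ^ 2 * (2 * 3 + 1) ^ 3 : ℕ) : ℝ))) + 1) ^ m + 1), div_pos (by positivity) hCpos, ?_⟩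
  intro F γ hFL hγ hγle J K hJK hKJ ε₀ hε₀ U hU hUg
  have hL1 : 1 ≤ F.L := F.hL.2.le
  -- the threshold along the whole history
  have hsmall : ∀ (i : ℕ) (hJi : J ≤ i) (hiK : i ≤ K), PlaqSmall θs (descendTo F ℰp i K hiK U) := by
    intro i hJi hiK
    have h := hUg (K - i) (by omega)
    have hle : θBal F.L γ b₀ p₀ (K - (K - i)) ≤ θs := hθ F.L hL1 γ hγ hγle _
    show PlaqSmall θs (fieldShift _ (Averaging.iter (fun i => BlockAveraging.blockAvg (P := F.P K) (j := i) ℰp) (K - i) U))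
    rw [plaqSmall_fieldShift]
    exact plaqSmall_of_le hle h
  -- the guards in the carrier's letters
  have hθ1 : ∀ K' : ℕ, Real.sqrt ((((F.P K').d ^ 2 * (2 * (2 * (F.P K').d * (F.P K').L + (F.P K').L) + 1) ^ (F.P K').d : ℕ) : ℝ)) * θs <
      deltaSU (Fin 2) / (((((F.P K').d + 2) * (F.P K').L : ℕ) : ℝ) ^ 2 / 4) := by
    intro K'
    have hd : (F.P K').d = 3 := T3Family.P_d F K'
    have hPL : (F.P K').L = L := by rw [← hFL]; rfl
    rw [hd, hPL]
    exact hg1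
  have hθ2 : ∀ K' : ℕ, Real.sqrt ((((F.P K').d ^ 2 * (2 * ((F.P K').d * (F.P K').L) + 1) ^ (F.P K').d * (2 * (F.P K').d + 1) ^ (F.P K').d : ℕ) : ℝ)) * θs <
      deltaSU (Fin 2) / (((((F.P K').d + 2) * (F.P K').L : ℕ) : ℝ) ^ 2 / 4) := by
    intro K'
    have hd : (F.P K').d = 3 := T3Family.P_d F K'
    have hPL : (F.P K').L = L := by rw [← hFL]; rfl
    rw [hd, hPL]
    exact hg2
  obtain ⟨w, hres, hsum⟩ := flat_tower F hθs0.le hθ1 hθ2 m K J hJK hKJ U hU hsmall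
  rw [hFL] at hsum
  -- the infimum is below the value at `w`
  have hinf : (⨅ w : {w : Site (F.P K) 0 → Matrix.specialUnitaryGroup (Fin 2) ℂ |
          ∀ U : GaugeField (F.P K) 0 (Matrix.specialUnitaryGroup (Fin 2) ℂ),
          descendTo F ℰp J K hJK (GaugeField.gaugeAct w U) = descendTo F ℰp J K hJK U},
          ∑ ℓ : PBond (F.P K) 0,
          dist1 (U ℓ * ((GaugeField.gaugeAct (w : Site (F.P K) 0 → Matrix.specialUnitaryGroup (Fin 2) ℂ) (1 : GaugeField (F.P K) 0 (Matrix.specialUnitaryGroup (Fin 2) ℂ))) ℓ)⁻¹) ^ 2)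
      ≤ ∑ ℓ : PBond (F.P K) 0, dist1 (U ℓ * ((GaugeField.gaugeAct w (1 : GaugeField (F.P K) 0 (Matrix.specialUnitaryGroup (Fin 2) ℂ))) ℓ)⁻¹) ^ 2 := by
    refine ciInf_le ⟨0, ?_⟩ (⟨w, hres⟩ : {w : Site (F.P K) 0 → Matrix.specialUnitaryGroup (Fin 2) ℂ |
          ∀ U : GaugeField (F.P K) 0 (Matrix.specialUnitaryGroup (Fin 2) ℂ),
          descendTo F ℰp J K hJK (GaugeField.gaugeAct w U) = descendTo F ℰp J K hJK U})
    rintro _ ⟨w', rfl⟩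
    exact Finset.sum_nonneg fun _ _ => sq_nonneg _
  rw [minActionRegPr_one F hε₀, sub_zero, hKJ, hFL]
  have hA0 : 0 ≤ wilsonAction4 U := wilsonAction4_nonneg U
  have hkey : ((L : ℝ) ^ 2) ^ m / (8 * ((2 * (((3 : ℕ) : ℝ) * (L : ℝ)) ^ 2 + 2 * (6 * ((((3 + 2) * L : ℕ) : ℝ) ^ 2 / 4)) + ((3 * ((L - 1) / 2) : ℕ) : ℝ) * (4 * (((3 : ℕ) : ℝ) * (L : ℝ)) ^ 2 + 2)) ^ 2 * ((3 * (2 * (2 * 3 * L + L + 3 * L) + 1) ^ 3 : ℕ) : ℝ)) * (2 * ((3 * (2 * (3 * L) + 1) ^ 3 : ℕ) : ℝ) * (((2 : ℕ) : ℝ) * (((L : ℝ) ^ 2 + 6 * (((3 + 2) * L : ℕ) : ℝ) ^ 2) ^ 2 * ((3 ^ 2 * (2 * 3 + 1) ^ 3 : ℕ) : ℝ))) + 1) ^ m + 1) * ((L : ℝ)⁻¹) ^ (2 * m) *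
      (∑ ℓ : PBond (F.P K) 0, dist1 (U ℓ * ((GaugeField.gaugeAct w (1 : GaugeField (F.P K) 0 (Matrix.specialUnitaryGroup (Fin 2) ℂ))) ℓ)⁻¹) ^ 2)
      ≤ wilsonAction4 U := by
    have hLne : (L : ℝ) ≠ 0 := hLr.ne'
    have hfac : ((L : ℝ) ^ 2) ^ m / (8 * ((2 * (((3 : ℕ) : ℝ) * (L : ℝ)) ^ 2 + 2 * (6 * ((((3 + 2) * L : ℕ) : ℝ) ^ 2 / 4)) + ((3 * ((L - 1) / 2) : ℕ) : ℝ) * (4 * (((3 : ℕ) : ℝ) * (L : ℝ)) ^ 2 + 2)) ^ 2 * ((3 * (2 * (2 * 3 * L + L + 3 * L) + 1) ^ 3 : ℕ) : ℝ)) * (2 * ((3 * (2 * (3 * L) + 1) ^ 3 : ℕ) : ℝ) * (((2 : ℕ) : ℝ) * (((L : ℝ) ^ 2 + 6 * (((3 + 2) * L : ℕ) : ℝ) ^ 2) ^ 2 * ((3 ^ 2 * (2 * 3 + 1) ^ 3 : ℕ) : ℝ))) + 1) ^ m + 1) * ((L : ℝ)⁻¹) ^ (2 * m) = 1 / (8 *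 ((2 * (((3 : ℕ) : ℝ) * (L : ℝ)) ^ 2 + 2 * (6 * ((((3 + 2) * L : ℕ) : ℝ) ^ 2 / 4)) + ((3 * ((L - 1) / 2) : ℕ) : ℝ) * (4 * (((3 : ℕ) : ℝ) * (L : ℝ)) ^ 2 + 2)) ^ 2 * ((3 * (2 * (2 * 3 * L + L + 3 * L) + 1) ^ 3 : ℕ) : ℝ)) * (2 * ((3 * (2 * (3 * L) + 1) ^ 3 : ℕ) : ℝ) * (((2 : ℕ) : ℝ) * (((L : ℝ) ^ 2 + 6 * (((3 + 2) * L : ℕ) : ℝ) ^ 2) ^ 2 * ((3 ^ 2 * (2 * 3 + 1) ^ 3 : ℕ) : ℝ))) + 1) ^ m + 1) := by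
      have hL2m : ((L : ℝ) ^ 2) ^ m ≠ 0 := pow_ne_zero _ (pow_ne_zero _ hLne)
      rw [pow_mul, inv_pow, inv_pow, div_mul_eq_mul_div, mul_inv_cancel₀ hL2m]
    rw [hfac, one_div, inv_mul_le_iff₀ hCpos]
    linarith [hsum]
  refine le_trans ?_ hkey
  exact mul_le_mul_of_nonneg_left hinf (by positivity)

end Final

end Summit.QuantumFields.YangMills.Theorems.FluctuationComparisonRegPrIntLS2BetaFlatTubeAllDepthsVolumeUniform

end
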